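import Summits.BirchSwinnertonDyer.Rank1Residual.Additive.X3BranchLineCharacterQuadratic
import HarnessLib

/-!
# X3 certificate road at `p = 3`: the per-pair line certificate WITH ITS CHARACTERS for a kernel
# discriminant `D = q₁q₂` (two distinct odd primes ≠ 3): character `(·/q₁)(·/q₂)` modulo `q₁q₂` when
# `q₁ ≡ q₂ (mod 4)`, and `χ₄·(·/q₁)(·/q₂)` modulo `4q₁q₂` when `q₁ ≡ 1`, `q₂ ≡ 3 (mod 4)` — cell `bsd-eis`,
# seat `bsd-eis-x3` gen 5; THEOREMS ONLY, nothing booked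

HONEST FRAMING (FULL-BSD rank-`≤ 1` programme D-0033, `run/shared/lean/pub/bsd-eis/README.md` §4;
excluded-domain X3 = additive reducible, row B2 `r = 0`, (M), NON-degenerate). A TOOL for the generated
per-pair displays on the composite kernel discriminants `D = q₁q₂` (`52` of the `116` composite classes:
`D ∈ {65, 85, 133, 145, 161, 185, 205, 209, 217, 221, 77}` with `q₁ ≡ q₂ (mod 4)`, and `D ∈ {35, 55}` with
`q₁ ≡ 1`, `q₂ ≡ 3`). Radicals: the product of the two Gauss sums (`t_i² = q_i*`), times `ζ₄` in the
mixed case (`q₁*q₂* = −q₁q₂`), multiplied by `Rat.smul_mul_eq_changeLevel_mul`; packaging by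
`exists_lineDatum_three_characters_of_cert_quadratic`.

* `legendreLegendreCharacter_three_isPrimitive` / `…_apply_natCast` — `(·/q₁)(·/q₂)` read in `𝔽₃`:
  primitive of conductor `q₁q₂`, value table;
* `legendreLegendreChi4Character_three_isPrimitive` / `…_apply_natCast` — `χ₄·(·/q₁)(·/q₂)`: conductor
  `4q₁q₂`, value table;
* `exists_lineDatum_three_characters_of_cert_two_primes` (`q₁ ≡ q₂ (mod 4)`),
  `exists_lineDatum_three_characters_of_cert_two_primes_chi4` (`q₁ ≡ 1`, `q₂ ≡ 3 (mod 4)`).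

References: [GreenbergVatsal2000] §2 p. 28; [Washington1997] Ch. 3; [IrelandRosen1990] Ch. 6 Prop. 6.3.2.
-/

set_option autoImplicit false

noncomputable section

open scoped Classical NumberField

namespace Summit.BirchSwinnertonDyer.Rank1Residual.Additive

open WeierstrassCurve Polynomial NumberField IsDedekindDomain Field
  Literature.NumberTheory.GaloisRepresentations
  Literature.NumberTheory.EllipticCurves
  Literature.NumberTheory.EllipticCurves.Rank1Residual
  Summit.BirchSwinnertonDyer.Rank1Residual.GaloisImage.RamifiedOrdinaryLineTwist

/-- Characters with coprime conductors: `f(χψ) = f(χ)·f(ψ)` (the tree's `X3BranchQuotCharacter` §1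
argument). [cite: Washington1997, Ch. 3 (conductor of a product of characters of coprime conductor)] -/
private theorem conductor_mul_eq_mul_of_coprime₄ {R : Type*} [CommRing R] [IsDomain R] {n : ℕ}
    [NeZero n] (χ ψ : DirichletCharacter R n) (h : χ.conductor.Coprime ψ.conductor) :
    (χ * ψ).conductor = χ.conductor * ψ.conductor := by
  apply Nat.dvd_antisymm
  · have := DirichletCharacter.conductor_mul_dvd_lcm_conductor χ ψ
    rwa [h.lcm_eq_mul] at this
  · have hχ : χ.conductor ∣ (χ * ψ).conductor := by
      have h1 : χ = (χ * ψ) * ψ⁻¹ := by rw [mul_assoc, mul_inv_cancel, mul_one]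
      have h2 := DirichletCharacter.conductor_mul_dvd_lcm_conductor (χ * ψ) ψ⁻¹
      rw [← h1, DirichletCharacter.conductor_inv] at h2
      exact h.dvd_of_dvd_mul_right (h2.trans (Nat.lcm_dvd_mul _ _))
    have hψ : ψ.conductor ∣ (χ * ψ).conductor := by
      have h1 : ψ = (χ * ψ) * χ⁻¹ := by rw [mul_comm χ ψ, mul_assoc, mul_inv_cancel, mul_one]
      have h2 := DirichletCharacter.conductor_mul_dvd_lcm_conductor (χ * ψ) χ⁻¹
      rw [← h1, DirichletCharacter.conductor_inv] at h2
      exact h.symm.dvd_of_dvd_mul_right (h2.trans (Nat.lcm_dvd_mul _ _))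
    exact h.mul_dvd_of_dvd_of_dvd hχ hψ

variable {q₁ q₂ : ℕ} [hq₁ : Fact q₁.Prime] [hq₂ : Fact q₂.Prime]

/-! ### §1 `(·/q₁)(·/q₂)` modulo `q₁q₂` -/

/-- **`φ = (·/q₁)(·/q₂)` read in `𝔽₃` is PRIMITIVE of conductor `q₁q₂`** (`q₁ ≠ q₂` odd primes): the
conductors `q₁`, `q₂` (`X3Branch.legendreCharacter_isPrimitive`) are coprime. [cite: Washington1997, Ch. 3 (conductors of Dirichlet characters)] -/
theorem legendreLegendreCharacter_three_isPrimitive (h12 : q₁ ≠ 2) (h22 : q₂ ≠ 2) (hne : q₁ ≠ q₂) :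
    DirichletCharacter.IsPrimitive
      ((DirichletCharacter.changeLevel (dvd_mul_right q₁ q₂) (quadraticChar (ZMod q₁)) *
          DirichletCharacter.changeLevel (dvd_mul_left q₂ q₁) (quadraticChar (ZMod q₂)) :
          MulChar (ZMod (q₁ * q₂)) ℤ).ringHomComp (Int.castRingHom (ZMod 3)) :
        DirichletCharacter (ZMod 3) (q₁ * q₂)) := by
  haveI : NeZero (q₁ * q₂) := ⟨mul_ne_zero hq₁.out.ne_zero hq₂.out.ne_zero⟩
  have hL1 : DirichletCharacter.conductor
      ((quadraticChar (ZMod q₁)).ringHomComp (Int.castRingHom (ZMod 3)) : DirichletCharacter (ZMod 3) q₁) = q₁ :=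
    X3Branch.legendreCharacter_isPrimitive (p := 3) (q := q₁) (by decide) h12
  have hL2 : DirichletCharacter.conductor
      ((quadraticChar (ZMod q₂)).ringHomComp (Int.castRingHom (ZMod 3)) : DirichletCharacter (ZMod 3) q₂) = q₂ :=
    X3Branch.legendreCharacter_isPrimitive (p := 3) (q := q₂) (by decide) h22
  have hcop : (DirichletCharacter.conductor (DirichletCharacter.changeLevel (dvd_mul_right q₁ q₂)
        ((quadraticChar (ZMod q₁)).ringHomComp (Int.castRingHom (ZMod 3)) : DirichletCharacter (ZMod 3) q₁))).Coprime
      (DirichletCharacter.conductor (DirichletCharacter.changeLevel (dvd_mul_left q₂ q₁)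
        ((quadraticChar (ZMod q₂)).ringHomComp (Int.castRingHom (ZMod 3)) : DirichletCharacter (ZMod 3) q₂))) := by
    rw [DirichletCharacter.conductor_changeLevel, DirichletCharacter.conductor_changeLevel, hL1, hL2]
    exact (Nat.coprime_primes hq₁.out hq₂.out).mpr hne
  rw [MulChar.ringHomComp_mul, DirichletCharacter.ringHomComp_changeLevel,
    DirichletCharacter.ringHomComp_changeLevel, DirichletCharacter.isPrimitive_def,
    conductor_mul_eq_mul_of_coprime₄ _ _ hcop, DirichletCharacter.conductor_changeLevel,
    DirichletCharacter.conductor_changeLevel, hL1, hL2]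

/-- **VALUE TABLE of `φ = (·/q₁)(·/q₂)` read in `𝔽₃`** on natural numbers (decidable form).
[cite: Washington1997, Ch. 3 (Dirichlet characters)] -/
theorem legendreLegendreCharacter_three_apply_natCast (a : ℕ) :
    ((DirichletCharacter.changeLevel (dvd_mul_right q₁ q₂) (quadraticChar (ZMod q₁)) *
          DirichletCharacter.changeLevel (dvd_mul_left q₂ q₁) (quadraticChar (ZMod q₂)) :
          MulChar (ZMod (q₁ * q₂)) ℤ).ringHomComp (Int.castRingHom (ZMod 3)) :
        DirichletCharacter (ZMod 3) (q₁ * q₂)) (a : ZMod (q₁ * q₂)) =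
      if a.Coprime (q₁ * q₂) then
        ((quadraticChar (ZMod q₁) (a : ZMod q₁) : ℤ) : ZMod 3) * ((quadraticChar (ZMod q₂) (a : ZMod q₂) : ℤ) : ZMod 3)
      else 0 := by
  haveI : NeZero (q₁ * q₂) := ⟨mul_ne_zero hq₁.out.ne_zero hq₂.out.ne_zero⟩
  by_cases hc : a.Coprime (q₁ * q₂)
  · rw [if_pos hc]
    have hu : IsUnit (a : ZMod (q₁ * q₂)) := (ZMod.isUnit_iff_coprime a (q₁ * q₂)).mpr hc
    obtain ⟨u, hu'⟩ := hu
    rw [← hu', MulChar.ringHomComp_apply, MulChar.mul_apply,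
      DirichletCharacter.changeLevel_eq_cast_of_dvd _ (dvd_mul_right q₁ q₂),
      DirichletCharacter.changeLevel_eq_cast_of_dvd _ (dvd_mul_left q₂ q₁), hu',
      ZMod.cast_natCast (dvd_mul_right q₁ q₂), ZMod.cast_natCast (dvd_mul_left q₂ q₁), map_mul, eq_intCast,
      eq_intCast]
  · rw [if_neg hc]
    exact MulChar.map_nonunit _ (fun h ↦ hc ((ZMod.isUnit_iff_coprime a (q₁ * q₂)).mp h))

/-! ### §2 `χ₄·(·/q₁)(·/q₂)` modulo `4q₁q₂` -/

/-- **`φ = χ₄·(·/q₁)(·/q₂)` read in `𝔽₃` is PRIMITIVE of conductor `4q₁q₂`** (`q₁ ≠ q₂` odd primes).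
[cite: Washington1997, Ch. 3 (conductors of Dirichlet characters)] -/
theorem legendreLegendreChi4Character_three_isPrimitive (h12 : q₁ ≠ 2) (h22 : q₂ ≠ 2) (hne : q₁ ≠ q₂) :
    DirichletCharacter.IsPrimitive
      ((DirichletCharacter.changeLevel (dvd_mul_right 4 (q₁ * q₂)) ZMod.χ₄ *
          DirichletCharacter.changeLevel (dvd_mul_left (q₁ * q₂) 4)
            (DirichletCharacter.changeLevel (dvd_mul_right q₁ q₂) (quadraticChar (ZMod q₁)) *
              DirichletCharacter.changeLevel (dvd_mul_left q₂ q₁) (quadraticChar (ZMod q₂)) :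
              MulChar (ZMod (q₁ * q₂)) ℤ) : MulChar (ZMod (4 * (q₁ * q₂))) ℤ).ringHomComp (Int.castRingHom (ZMod 3)) :
        DirichletCharacter (ZMod 3) (4 * (q₁ * q₂))) := by
  haveI : NeZero (q₁ * q₂) := ⟨mul_ne_zero hq₁.out.ne_zero hq₂.out.ne_zero⟩
  haveI : NeZero (4 * (q₁ * q₂)) := ⟨mul_ne_zero (by norm_num) (mul_ne_zero hq₁.out.ne_zero hq₂.out.ne_zero)⟩
  have h4 : DirichletCharacter.conductor
      (ZMod.χ₄.ringHomComp (Int.castRingHom (ZMod 3)) : DirichletCharacter (ZMod 3) 4) = 4 :=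
    chi4_three_isPrimitive
  have hL : DirichletCharacter.conductor
      ((DirichletCharacter.changeLevel (dvd_mul_right q₁ q₂) (quadraticChar (ZMod q₁)) *
          DirichletCharacter.changeLevel (dvd_mul_left q₂ q₁) (quadraticChar (ZMod q₂)) :
          MulChar (ZMod (q₁ * q₂)) ℤ).ringHomComp (Int.castRingHom (ZMod 3)) :
        DirichletCharacter (ZMod 3) (q₁ * q₂)) = q₁ * q₂ :=
    legendreLegendreCharacter_three_isPrimitive h12 h22 hne
  have hcop4 : Nat.Coprime 4 (q₁ * q₂) := by
    rw [show (4 : ℕ) = 2 ^ 2 by norm_num]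
    exact Nat.Coprime.pow_left 2 (Nat.Coprime.mul_right
      ((Nat.coprime_primes Nat.prime_two hq₁.out).mpr (Ne.symm h12))
      ((Nat.coprime_primes Nat.prime_two hq₂.out).mpr (Ne.symm h22)))
  have hcop : (DirichletCharacter.conductor (DirichletCharacter.changeLevel (dvd_mul_right 4 (q₁ * q₂))
        (ZMod.χ₄.ringHomComp (Int.castRingHom (ZMod 3)) : DirichletCharacter (ZMod 3) 4))).Coprime
      (DirichletCharacter.conductor (DirichletCharacter.changeLevel (dvd_mul_left (q₁ * q₂) 4)
        ((DirichletCharacter.changeLevel (dvd_mul_right q₁ q₂) (quadraticChar (ZMod q₁)) *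
          DirichletCharacter.changeLevel (dvd_mul_left q₂ q₁) (quadraticChar (ZMod q₂)) :
          MulChar (ZMod (q₁ * q₂)) ℤ).ringHomComp (Int.castRingHom (ZMod 3)) :
        DirichletCharacter (ZMod 3) (q₁ * q₂)))) := by
    rw [DirichletCharacter.conductor_changeLevel, DirichletCharacter.conductor_changeLevel, h4, hL]
    exact hcop4
  rw [MulChar.ringHomComp_mul, DirichletCharacter.ringHomComp_changeLevel,
    DirichletCharacter.ringHomComp_changeLevel, DirichletCharacter.isPrimitive_def,
    conductor_mul_eq_mul_of_coprime₄ _ _ hcop, DirichletCharacter.conductor_changeLevel,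
    DirichletCharacter.conductor_changeLevel, h4, hL]

/-- **VALUE TABLE of `φ = χ₄·(·/q₁)(·/q₂)` read in `𝔽₃`** on natural numbers (decidable form).
[cite: Washington1997, Ch. 3 (Dirichlet characters)] -/
theorem legendreLegendreChi4Character_three_apply_natCast (a : ℕ) :
    ((DirichletCharacter.changeLevel (dvd_mul_right 4 (q₁ * q₂)) ZMod.χ₄ *
          DirichletCharacter.changeLevel (dvd_mul_left (q₁ * q₂) 4)
            (DirichletCharacter.changeLevel (dvd_mul_right q₁ q₂) (quadraticChar (ZMod q₁)) *
              DirichletCharacter.changeLevel (dvd_mul_left q₂ q₁) (quadraticChar (ZMod q₂)) :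
              MulChar (ZMod (q₁ * q₂)) ℤ) : MulChar (ZMod (4 * (q₁ * q₂))) ℤ).ringHomComp (Int.castRingHom (ZMod 3)) :
        DirichletCharacter (ZMod 3) (4 * (q₁ * q₂))) (a : ZMod (4 * (q₁ * q₂))) =
      if a.Coprime (4 * (q₁ * q₂)) then
        ((ZMod.χ₄ (a : ZMod 4) : ℤ) : ZMod 3) *
          (((quadraticChar (ZMod q₁) (a : ZMod q₁) : ℤ) : ZMod 3) * ((quadraticChar (ZMod q₂) (a : ZMod q₂) : ℤ) : ZMod 3))
      else 0 := by
  haveI : NeZero (q₁ * q₂) := ⟨mul_ne_zero hq₁.out.ne_zero hq₂.out.ne_zero⟩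
  haveI : NeZero (4 * (q₁ * q₂)) := ⟨mul_ne_zero (by norm_num) (mul_ne_zero hq₁.out.ne_zero hq₂.out.ne_zero)⟩
  by_cases hc : a.Coprime (4 * (q₁ * q₂))
  · rw [if_pos hc]
    have hc' : a.Coprime (q₁ * q₂) := Nat.Coprime.coprime_mul_left_right hc
    have hu : IsUnit (a : ZMod (4 * (q₁ * q₂))) := (ZMod.isUnit_iff_coprime a _).mpr hc
    obtain ⟨u, hu'⟩ := hu
    have hu2 : IsUnit (a : ZMod (q₁ * q₂)) := (ZMod.isUnit_iff_coprime a _).mpr hc'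
    obtain ⟨u2, hu2'⟩ := hu2
    rw [← hu', MulChar.ringHomComp_apply, MulChar.mul_apply,
      DirichletCharacter.changeLevel_eq_cast_of_dvd _ (dvd_mul_right 4 (q₁ * q₂)),
      DirichletCharacter.changeLevel_eq_cast_of_dvd _ (dvd_mul_left (q₁ * q₂) 4), hu',
      ZMod.cast_natCast (dvd_mul_right 4 (q₁ * q₂)), ZMod.cast_natCast (dvd_mul_left (q₁ * q₂) 4),
      ← hu2', MulChar.mul_apply,
      DirichletCharacter.changeLevel_eq_cast_of_dvd _ (dvd_mul_right q₁ q₂),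
      DirichletCharacter.changeLevel_eq_cast_of_dvd _ (dvd_mul_left q₂ q₁), hu2',
      ZMod.cast_natCast (dvd_mul_right q₁ q₂), ZMod.cast_natCast (dvd_mul_left q₂ q₁), map_mul, map_mul,
      eq_intCast, eq_intCast, eq_intCast]
  · rw [if_neg hc]
    exact MulChar.map_nonunit _ (fun h ↦ hc ((ZMod.isUnit_iff_coprime a _).mp h))

/-! ### §3 The packagings -/

variable {W : WeierstrassCurve ℚ} [W.IsElliptic]

/-- Common numerology of two distinct primes `q₁, q₂ ≠ 3`: `q₁q₂` is squarefree, `> 0`, `≠ 1`,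
prime to `3`. [folklore] -/
private theorem two_primes_numerology (h13 : q₁ ≠ 3) (h23 : q₂ ≠ 3) (hne : q₁ ≠ q₂) :
    Squarefree ((q₁ * q₂ : ℕ) : ℤ) ∧ (0 : ℤ) < (q₁ * q₂ : ℕ) ∧ ((q₁ * q₂ : ℕ) : ℤ) ≠ 1 ∧
      ¬ (3 : ℤ) ∣ ((q₁ * q₂ : ℕ) : ℤ) ∧ ¬ 3 ∣ q₁ * q₂ := by
  have hp1 := hq₁.out; have hp2 := hq₂.out
  have hsqN : Squarefree (q₁ * q₂) := by
    rw [Nat.squarefree_mul ((Nat.coprime_primes hp1 hp2).mpr hne)]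
    exact ⟨hp1.squarefree, hp2.squarefree⟩
  have h3 : ¬ 3 ∣ q₁ * q₂ := by
    intro h
    rcases (Nat.Prime.dvd_mul Nat.prime_three).mp h with h | h
    · rcases (Nat.dvd_prime hp1).mp h with h' | h'
      · norm_num at h'
      · exact h13 h'.symm
    · rcases (Nat.dvd_prime hp2).mp h with h' | h'
      · norm_num at h'
      · exact h23 h'.symm
  refine ⟨Int.squarefree_natCast.mpr hsqN, by exact_mod_cast Nat.mul_pos hp1.pos hp2.pos, ?_, ?_, h3⟩
  · have : 1 < q₁ * q₂ := Nat.one_lt_mul_iff.mpr ⟨hp1.pos, hp2.pos, Or.inl hp1.one_lt⟩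
    omega
  · intro h; exact h3 (by exact_mod_cast h)

/-- **The line datum WITH ITS TWO CHARACTERS for `D = q₁q₂`, `q₁ ≡ q₂ (mod 4)`** (distinct odd primes
`∉ {2, 3}`). Certificate `(x₀, s)`: `Ψ₃(x₀) = 0`, `s ≠ 0`, `q₁q₂·s² = Ψ₂Sq(x₀)`. Character
`φ = (·/q₁)(·/q₂)` read in `𝔽₃` (radical `t₁t₂`, `t_i` the Gauss sums, `(t₁t₂)² = q₁*q₂* = q₁q₂`), quotient
character of level `3q₁q₂`. [folklore] -/
theorem exists_lineDatum_three_characters_of_cert_two_primes [hp : Fact (Nat.Prime 3)] {x₀ s : ℚ}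
    (hmod : q₁ % 4 = 1 ∧ q₂ % 4 = 1 ∨ q₁ % 4 = 3 ∧ q₂ % 4 = 3) (h13 : q₁ ≠ 3) (h23 : q₂ ≠ 3)
    (hne : q₁ ≠ q₂) (hψ : W.Ψ₃.eval x₀ = 0) (hs : s ≠ 0)
    (hDs : (((q₁ * q₂ : ℕ) : ℤ) : ℚ) * s ^ 2 = W.Ψ₂Sq.eval x₀) :
    ∃ Φ₀ : AddSubgroup (geomTorsion W ((3 : ℕ) : ℤ)), IsRationalLine W 3 Φ₀ ∧ LineEven W 3 Φ₀ ∧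
      (∃ (σ : absoluteGaloisGroup ℚ) (P : W.geomTorsion ((3 : ℕ) : ℤ)), P ∈ Φ₀ ∧ σ • P ≠ P) ∧
      (∀ (K : Type) [Field K] [NumberField K] [(galRange (K := ℚ) K).Normal],
        Module.finrank ℚ K = 2 →
        (∃ θ : K, θ ^ 2 = algebraMap ℚ K ((-1) ^ ((3 : ℕ) / 2) * (3 : ℕ))) →
        ¬ ∀ v : HeightOneSpectrum (𝓞 ℚ), (((3 : ℕ) : ℕ) : 𝓞 ℚ) ∈ v.asIdeal →
          ∀ 𝔓 ∈ v.primesAbove, ∀ σ ∈ 𝔓.inertia (absoluteGaloisGroup ℚ), ∀ P ∈ Φ₀,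
            σ • P = (if σ ∈ galRange (K := ℚ) K then P else -P)) ∧
      DirichletCharacter.IsPrimitive
        ((DirichletCharacter.changeLevel (dvd_mul_right q₁ q₂) (quadraticChar (ZMod q₁)) *
            DirichletCharacter.changeLevel (dvd_mul_left q₂ q₁) (quadraticChar (ZMod q₂)) :
            MulChar (ZMod (q₁ * q₂)) ℤ).ringHomComp (Int.castRingHom (ZMod 3)) :
          DirichletCharacter (ZMod 3) (q₁ * q₂)) ∧
      (∀ (σ : absoluteGaloisGroup ℚ), ∀ P ∈ Φ₀,
        σ • P = (((DirichletCharacter.changeLevel (dvd_mul_right q₁ q₂) (quadraticChar (ZMod q₁)) *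
            DirichletCharacter.changeLevel (dvd_mul_left q₂ q₁) (quadraticChar (ZMod q₂)) :
            MulChar (ZMod (q₁ * q₂)) ℤ).ringHomComp (Int.castRingHom (ZMod 3)) :
          DirichletCharacter (ZMod 3) (q₁ * q₂))
          ((modNCyclotomicCharacter ℚ (q₁ * q₂) σ : (ZMod (q₁ * q₂))ˣ) : ZMod (q₁ * q₂))).val • P) ∧
      DirichletCharacter.IsPrimitive
        (DirichletCharacter.changeLevel (dvd_mul_right 3 (q₁ * q₂)) (MulChar.ofUnitHom (MonoidHom.id (ZMod 3)ˣ)) *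
          DirichletCharacter.changeLevel (dvd_mul_left (q₁ * q₂) 3)
            ((DirichletCharacter.changeLevel (dvd_mul_right q₁ q₂) (quadraticChar (ZMod q₁)) *
              DirichletCharacter.changeLevel (dvd_mul_left q₂ q₁) (quadraticChar (ZMod q₂)) :
              MulChar (ZMod (q₁ * q₂)) ℤ).ringHomComp (Int.castRingHom (ZMod 3)) :
            DirichletCharacter (ZMod 3) (q₁ * q₂))⁻¹ :
          DirichletCharacter (ZMod 3) (3 * (q₁ * q₂))) ∧
      (∀ (σ : absoluteGaloisGroup ℚ) (P : W.geomTorsion ((3 : ℕ) : ℤ)),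
        σ • P - ((DirichletCharacter.changeLevel (dvd_mul_right 3 (q₁ * q₂))
            (MulChar.ofUnitHom (MonoidHom.id (ZMod 3)ˣ)) *
          DirichletCharacter.changeLevel (dvd_mul_left (q₁ * q₂) 3)
            ((DirichletCharacter.changeLevel (dvd_mul_right q₁ q₂) (quadraticChar (ZMod q₁)) *
              DirichletCharacter.changeLevel (dvd_mul_left q₂ q₁) (quadraticChar (ZMod q₂)) :
              MulChar (ZMod (q₁ * q₂)) ℤ).ringHomComp (Int.castRingHom (ZMod 3)) :
            DirichletCharacter (ZMod 3) (q₁ * q₂))⁻¹ :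
          DirichletCharacter (ZMod 3) (3 * (q₁ * q₂)))
          ((modNCyclotomicCharacter ℚ (3 * (q₁ * q₂)) σ : (ZMod (3 * (q₁ * q₂)))ˣ) : ZMod (3 * (q₁ * q₂)))).val • P ∈ Φ₀) := by
  have hp1 := hq₁.out; have hp2 := hq₂.out
  haveI : NeZero q₁ := ⟨hp1.ne_zero⟩
  haveI : NeZero q₂ := ⟨hp2.ne_zero⟩
  haveI : NeZero (q₁ * q₂) := ⟨mul_ne_zero hp1.ne_zero hp2.ne_zero⟩
  haveI : NeZero (q₁ : ℚ) := ⟨by exact_mod_cast hp1.ne_zero⟩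
  haveI : NeZero (q₂ : ℚ) := ⟨by exact_mod_cast hp2.ne_zero⟩
  have h12 : q₁ ≠ 2 := by rintro rfl; rcases hmod with ⟨h, _⟩ | ⟨h, _⟩ <;> norm_num at h
  have h22 : q₂ ≠ 2 := by rintro rfl; rcases hmod with ⟨_, h⟩ | ⟨_, h⟩ <;> norm_num at h
  obtain ⟨hsq, hpos, hD1, h3D, h3N⟩ := two_primes_numerology h13 h23 hne
  obtain ⟨t₁, ht₁0, ht₁2, ht₁⟩ := Rat.exists_gaussSum (p := q₁) h12
  obtain ⟨t₂, ht₂0, ht₂2, ht₂⟩ := Rat.exists_gaussSum (p := q₂) h22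
  have hc1 : ringChar (ZMod q₁) ≠ 2 := by rwa [ZMod.ringChar_zmod_n]
  have hc2 : ringChar (ZMod q₂) ≠ 2 := by rwa [ZMod.ringChar_zmod_n]
  have hg2 : (t₁ * t₂) ^ 2 = ((((q₁ * q₂ : ℕ) : ℤ) : ℚ) : AlgebraicClosure ℚ) := by
    rw [mul_pow, ht₁2, ht₂2, quadraticChar_neg_one hc1, quadraticChar_neg_one hc2, ZMod.card q₁, ZMod.card q₂]
    rcases hmod with ⟨h1, h2⟩ | ⟨h1, h2⟩
    · rw [ZMod.χ₄_nat_one_mod_four h1, ZMod.χ₄_nat_one_mod_four h2]; push_cast; ring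
    · rw [ZMod.χ₄_nat_three_mod_four h1, ZMod.χ₄_nat_three_mod_four h2]; push_cast; ring
  have hg0 : t₁ * t₂ ≠ 0 := mul_ne_zero ht₁0 ht₂0
  have hgs := Rat.smul_mul_eq_changeLevel_mul (dvd_mul_right q₁ q₂) (dvd_mul_left q₂ q₁)
    (quadraticChar (ZMod q₁)) (quadraticChar (ZMod q₂)) ht₁ ht₂
  have hχ2 : ((DirichletCharacter.changeLevel (dvd_mul_right q₁ q₂) (quadraticChar (ZMod q₁)) *
      DirichletCharacter.changeLevel (dvd_mul_left q₂ q₁) (quadraticChar (ZMod q₂)) :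
      MulChar (ZMod (q₁ * q₂)) ℤ)).IsQuadratic :=
    MulChar.IsQuadratic.mul_int (MulChar.IsQuadratic.changeLevel_int (quadraticChar_isQuadratic (ZMod q₁)) _)
      (MulChar.IsQuadratic.changeLevel_int (quadraticChar_isQuadratic (ZMod q₂)) _)
  exact exists_lineDatum_three_characters_of_cert_quadratic _ hχ2
    (legendreLegendreCharacter_three_isPrimitive h12 h22 hne) h3N hg0 hg2 hgs hψ hsq hs hDs hpos hD1 h3D

/-- **The line datum WITH ITS TWO CHARACTERS for `D = q₁q₂`, `q₁ ≡ 1`, `q₂ ≡ 3 (mod 4)`** (primes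
`∉ {2, 3}`). Character `φ = χ₄·(·/q₁)(·/q₂)` read in `𝔽₃` modulo `4q₁q₂` (radical `ζ₄·t₁t₂`:
`(t₁t₂)² = q₁*q₂* = −q₁q₂`), quotient character of level `3·(4q₁q₂)`. [folklore] -/
theorem exists_lineDatum_three_characters_of_cert_two_primes_chi4 [hp : Fact (Nat.Prime 3)] {x₀ s : ℚ}
    (h1 : q₁ % 4 = 1) (h2 : q₂ % 4 = 3) (h13 : q₁ ≠ 3) (h23 : q₂ ≠ 3)
    (hψ : W.Ψ₃.eval x₀ = 0) (hs : s ≠ 0)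
    (hDs : (((q₁ * q₂ : ℕ) : ℤ) : ℚ) * s ^ 2 = W.Ψ₂Sq.eval x₀) :
    ∃ Φ₀ : AddSubgroup (geomTorsion W ((3 : ℕ) : ℤ)), IsRationalLine W 3 Φ₀ ∧ LineEven W 3 Φ₀ ∧
      (∃ (σ : absoluteGaloisGroup ℚ) (P : W.geomTorsion ((3 : ℕ) : ℤ)), P ∈ Φ₀ ∧ σ • P ≠ P) ∧
      (∀ (K : Type) [Field K] [NumberField K] [(galRange (K := ℚ) K).Normal],
        Module.finrank ℚ K = 2 →
        (∃ θ : K, θ ^ 2 = algebraMap ℚ K ((-1) ^ ((3 : ℕ) / 2) * (3 : ℕ))) →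
        ¬ ∀ v : HeightOneSpectrum (𝓞 ℚ), (((3 : ℕ) : ℕ) : 𝓞 ℚ) ∈ v.asIdeal →
          ∀ 𝔓 ∈ v.primesAbove, ∀ σ ∈ 𝔓.inertia (absoluteGaloisGroup ℚ), ∀ P ∈ Φ₀,
            σ • P = (if σ ∈ galRange (K := ℚ) K then P else -P)) ∧
      DirichletCharacter.IsPrimitive
        ((DirichletCharacter.changeLevel (dvd_mul_right 4 (q₁ * q₂)) ZMod.χ₄ *
            DirichletCharacter.changeLevel (dvd_mul_left (q₁ * q₂) 4)
              (DirichletCharacter.changeLevel (dvd_mul_right q₁ q₂) (quadraticChar (ZMod q₁)) *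
                DirichletCharacter.changeLevel (dvd_mul_left q₂ q₁) (quadraticChar (ZMod q₂)) :
                MulChar (ZMod (q₁ * q₂)) ℤ) : MulChar (ZMod (4 * (q₁ * q₂))) ℤ).ringHomComp
            (Int.castRingHom (ZMod 3)) : DirichletCharacter (ZMod 3) (4 * (q₁ * q₂))) ∧
      (∀ (σ : absoluteGaloisGroup ℚ), ∀ P ∈ Φ₀,
        σ • P = (((DirichletCharacter.changeLevel (dvd_mul_right 4 (q₁ * q₂)) ZMod.χ₄ *
            DirichletCharacter.changeLevel (dvd_mul_left (q₁ * q₂) 4)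
              (DirichletCharacter.changeLevel (dvd_mul_right q₁ q₂) (quadraticChar (ZMod q₁)) *
                DirichletCharacter.changeLevel (dvd_mul_left q₂ q₁) (quadraticChar (ZMod q₂)) :
                MulChar (ZMod (q₁ * q₂)) ℤ) : MulChar (ZMod (4 * (q₁ * q₂))) ℤ).ringHomComp
            (Int.castRingHom (ZMod 3)) : DirichletCharacter (ZMod 3) (4 * (q₁ * q₂)))
          ((modNCyclotomicCharacter ℚ (4 * (q₁ * q₂)) σ : (ZMod (4 * (q₁ * q₂)))ˣ) : ZMod (4 * (q₁ * q₂)))).val • P) ∧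
      DirichletCharacter.IsPrimitive
        (DirichletCharacter.changeLevel (dvd_mul_right 3 (4 * (q₁ * q₂)))
            (MulChar.ofUnitHom (MonoidHom.id (ZMod 3)ˣ)) *
          DirichletCharacter.changeLevel (dvd_mul_left (4 * (q₁ * q₂)) 3)
            ((DirichletCharacter.changeLevel (dvd_mul_right 4 (q₁ * q₂)) ZMod.χ₄ *
              DirichletCharacter.changeLevel (dvd_mul_left (q₁ * q₂) 4)
                (DirichletCharacter.changeLevel (dvd_mul_right q₁ q₂) (quadraticChar (ZMod q₁)) *
                  DirichletCharacter.changeLevel (dvd_mul_left q₂ q₁) (quadraticChar (ZMod q₂)) :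
                  MulChar (ZMod (q₁ * q₂)) ℤ) : MulChar (ZMod (4 * (q₁ * q₂))) ℤ).ringHomComp
              (Int.castRingHom (ZMod 3)) : DirichletCharacter (ZMod 3) (4 * (q₁ * q₂)))⁻¹ :
          DirichletCharacter (ZMod 3) (3 * (4 * (q₁ * q₂)))) ∧
      (∀ (σ : absoluteGaloisGroup ℚ) (P : W.geomTorsion ((3 : ℕ) : ℤ)),
        σ • P - ((DirichletCharacter.changeLevel (dvd_mul_right 3 (4 * (q₁ * q₂)))
            (MulChar.ofUnitHom (MonoidHom.id (ZMod 3)ˣ)) *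
          DirichletCharacter.changeLevel (dvd_mul_left (4 * (q₁ * q₂)) 3)
            ((DirichletCharacter.changeLevel (dvd_mul_right 4 (q₁ * q₂)) ZMod.χ₄ *
              DirichletCharacter.changeLevel (dvd_mul_left (q₁ * q₂) 4)
                (DirichletCharacter.changeLevel (dvd_mul_right q₁ q₂) (quadraticChar (ZMod q₁)) *
                  DirichletCharacter.changeLevel (dvd_mul_left q₂ q₁) (quadraticChar (ZMod q₂)) :
                  MulChar (ZMod (q₁ * q₂)) ℤ) : MulChar (ZMod (4 * (q₁ * q₂))) ℤ).ringHomComp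
              (Int.castRingHom (ZMod 3)) : DirichletCharacter (ZMod 3) (4 * (q₁ * q₂)))⁻¹ :
          DirichletCharacter (ZMod 3) (3 * (4 * (q₁ * q₂))))
          ((modNCyclotomicCharacter ℚ (3 * (4 * (q₁ * q₂))) σ : (ZMod (3 * (4 * (q₁ * q₂))))ˣ) :
            ZMod (3 * (4 * (q₁ * q₂))))).val • P ∈ Φ₀) := by
  have hp1 := hq₁.out; have hp2 := hq₂.out
  haveI : NeZero q₁ := ⟨hp1.ne_zero⟩
  haveI : NeZero q₂ := ⟨hp2.ne_zero⟩
  haveI : NeZero (q₁ * q₂) := ⟨mul_ne_zero hp1.ne_zero hp2.ne_zero⟩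
  haveI : NeZero (4 * (q₁ * q₂)) := ⟨mul_ne_zero (by norm_num) (mul_ne_zero hp1.ne_zero hp2.ne_zero)⟩
  haveI : NeZero (q₁ : ℚ) := ⟨by exact_mod_cast hp1.ne_zero⟩
  haveI : NeZero (q₂ : ℚ) := ⟨by exact_mod_cast hp2.ne_zero⟩
  have h12 : q₁ ≠ 2 := by rintro rfl; norm_num at h1
  have h22 : q₂ ≠ 2 := by rintro rfl; norm_num at h2
  have hne : q₁ ≠ q₂ := by rintro rfl; omega
  obtain ⟨hsq, hpos, hD1, h3D, h3N⟩ := two_primes_numerology h13 h23 hne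
  have h3N' : ¬ 3 ∣ 4 * (q₁ * q₂) := by
    intro h
    rcases (Nat.Prime.dvd_mul Nat.prime_three).mp h with h | h
    · norm_num at h
    · exact h3N h
  obtain ⟨i, hi0, hi2, hi⟩ := Rat.exists_sqrt_neg_one_smul_eq_chi4
  obtain ⟨t₁, ht₁0, ht₁2, ht₁⟩ := Rat.exists_gaussSum (p := q₁) h12
  obtain ⟨t₂, ht₂0, ht₂2, ht₂⟩ := Rat.exists_gaussSum (p := q₂) h22
  have hc1 : ringChar (ZMod q₁) ≠ 2 := by rwa [ZMod.ringChar_zmod_n]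
  have hc2 : ringChar (ZMod q₂) ≠ 2 := by rwa [ZMod.ringChar_zmod_n]
  have hg2 : (i * (t₁ * t₂)) ^ 2 = ((((q₁ * q₂ : ℕ) : ℤ) : ℚ) : AlgebraicClosure ℚ) := by
    rw [mul_pow, mul_pow, hi2, ht₁2, ht₂2, quadraticChar_neg_one hc1, quadraticChar_neg_one hc2, ZMod.card q₁,
      ZMod.card q₂, ZMod.χ₄_nat_one_mod_four h1, ZMod.χ₄_nat_three_mod_four h2]
    push_cast
    ring
  have hg0 : i * (t₁ * t₂) ≠ 0 := mul_ne_zero hi0 (mul_ne_zero ht₁0 ht₂0)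
  have hgs12 := Rat.smul_mul_eq_changeLevel_mul (dvd_mul_right q₁ q₂) (dvd_mul_left q₂ q₁)
    (quadraticChar (ZMod q₁)) (quadraticChar (ZMod q₂)) ht₁ ht₂
  have hgs := Rat.smul_mul_eq_changeLevel_mul (dvd_mul_right 4 (q₁ * q₂)) (dvd_mul_left (q₁ * q₂) 4) ZMod.χ₄
    (DirichletCharacter.changeLevel (dvd_mul_right q₁ q₂) (quadraticChar (ZMod q₁)) *
      DirichletCharacter.changeLevel (dvd_mul_left q₂ q₁) (quadraticChar (ZMod q₂)) : MulChar (ZMod (q₁ * q₂)) ℤ)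
    hi hgs12
  have hχ2 : ((DirichletCharacter.changeLevel (dvd_mul_right 4 (q₁ * q₂)) ZMod.χ₄ *
      DirichletCharacter.changeLevel (dvd_mul_left (q₁ * q₂) 4)
        (DirichletCharacter.changeLevel (dvd_mul_right q₁ q₂) (quadraticChar (ZMod q₁)) *
          DirichletCharacter.changeLevel (dvd_mul_left q₂ q₁) (quadraticChar (ZMod q₂)) :
          MulChar (ZMod (q₁ * q₂)) ℤ) : MulChar (ZMod (4 * (q₁ * q₂))) ℤ)).IsQuadratic :=
    MulChar.IsQuadratic.mul_int (MulChar.IsQuadratic.changeLevel_int ZMod.isQuadratic_χ₄ _)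
      (MulChar.IsQuadratic.changeLevel_int
        (MulChar.IsQuadratic.mul_int (MulChar.IsQuadratic.changeLevel_int (quadraticChar_isQuadratic (ZMod q₁)) _)
          (MulChar.IsQuadratic.changeLevel_int (quadraticChar_isQuadratic (ZMod q₂)) _)) _)
  exact exists_lineDatum_three_characters_of_cert_quadratic _ hχ2
    (legendreLegendreChi4Character_three_isPrimitive h12 h22 hne) h3N' hg0 hg2 hgs hψ hsq hs hDs hpos hD1 h3D

end Summit.BirchSwinnertonDyer.Rank1Residual.Additive

end
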